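import Mathlib
import HarnessLib
import Literature.Analysis.FluidPDE.SelfSimilar
import Literature.Analysis.FluidPDE.TsaiSelfSimilarBounded
import Summits.NavierStokesRegularity.NavierStokesRegularity.Theses.AngularGalerkinLadder

/-! # Side statements of line `leray` (crux `RungBlowupCofinal`, item stmt-NavierStokesRegularity-19959) —
# SPECTRAL SATURATION of steady rung profiles (NOT a skeleton, NOT registered; cstrat-19959 g0, 2026-08-27)

A typed structural constraint that every object of `stub_nondegenerate_approx_profiles_cofinal` /
`RungHasLerayProfile` must obey, offered to the KJ pen (refuters) as a landable Negative-side lemma and to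
stub provers as the reason profiles are TRUNCATION-THRESHOLD objects (card `Lines/leray.md`, «Hardest stub»,
mechanism (β)). SELF-CONTAINED: crux workfiles are not importable modules, so the two definitions of
`Lines/leray.lean` this file speaks about (`lerayResidual`, `IsSteadyLerayRungProfile`) are re-declared VERBATIM in the
sub-namespace `…Leray.Side` (same text, same meaning; nothing else of the line is needed).

CLAIM (`spectralSaturation`, composition of the two statements below): a steady rung-`L` Leray profile
`IsSteadyLerayRungProfile L C U Q E` whose angular spectrum lies in degrees `≤ M` with `2M ≤ L` is trivial.

* `side_defect_absorbed` (OWED — representation theory + calculus, M-sized): rotation-equivariant linear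
  differential operators (`A = −Δ + ½ + ½y·∇`, `∇`, `U ↦ ∇U`) preserve the isotypic label `j` of the `SO(3)`-action
  `(R·u)(x) = R u(R⁻¹x)` (Schur), and a pointwise product of a `j₁`- and a `j₂`-isotypic field has labels in
  `[|j₁−j₂|, j₁+j₂]` (Clebsch–Gordan); hence for `U` band-limited to `M`, `(U·∇)U` is band-limited to `2M ≤ L`,
  so `E = (1 − Π_L)(∇Q)` is the gradient of `(1 − π_L)Q` (a smooth co-band-limited `E` has `Π_L E = 0`: test
  against `Π_L φ`, `φ ∈ C_c^∞`, using the symmetry of the character projector), and `U` solves the GENUINE profile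
  equation with the smooth pressure `π_L Q`: `lerayResidual U (π_L Q) 0 = 0`.
* `eq_zero_of_lerayResidual_zero` (PROVED here from the tree): a smooth solution of the genuine steady Leray
  system (`ν = 1`, `a = ½`) with `‖U(y)‖ ≤ C/(‖y‖+1)` vanishes identically — Tsai 1998 Thm 1 (`q = ∞`), tree theorem
  `Literature.Analysis.FluidPDE.IsLerayProfile.exists_eq_const_of_bounded` (sorry-free), plus decay.

MODEL gloss (eng-2 deposit HOME/profile/z2oct/census/j272443/ladder.json, N128_R160, O_h ℓ-ladder): the rung-6 and
rung-8 roots are > 99.7 % degree-4 (`‖Q₆‖/‖Q₄‖ ≈ 2.9e-3` at rung 6; `‖Q₆‖/‖Q₄‖ ≈ 1.9e-3`, `‖Q₈‖/‖Q₄‖ ≈ 5.6e-4` at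
rung 8): by the claim the sliver in degrees `> L/2` can never vanish — the roots are `1e-3`-approximate GENUINE Leray
profiles («pseudo-profiles») that exist only because they drift to infinity (`ρ_A ≈ 3.3·L`), where Tsai's theorem has
no uniformity. LABEL: KERNEL side-lemma + one sorried statement; WHAT THIS IS NOT: not NS, not a stub, no item moves.
-/

noncomputable section

open scoped Topology Laplacian ContDiff
open Filter Set
open Summit.NavierStokesRegularity.FluidComputer Literature.Analysis.FluidPDE

set_option linter.dupNamespace false

namespace Summit.NavierStokesRegularity.NavierStokesRegularity.Cruxes.RungBlowupCofinal.Leray.Side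

local notation "ℝ³" => EuclideanSpace ℝ (Fin 3)

/-- VERBATIM COPY of `Lines/leray.lean`'s `lerayResidual`: the steady Leray (backward-similarity, `a = ½`, `ν = 1`)
residual with pressure `Q` and defect `E`. [folklore] -/
noncomputable def lerayResidual (U : ℝ³ → ℝ³) (Q : ℝ³ → ℝ) (E : ℝ³ → ℝ³) (y : ℝ³) : ℝ³ :=
  -(Δ U) y + (1 / 2 : ℝ) • U y + (1 / 2 : ℝ) • fderiv ℝ U y y + convect U U y + gradient Q y - E y

/-- VERBATIM COPY of `Lines/leray.lean`'s `IsSteadyLerayRungProfile`. [folklore] -/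
def IsSteadyLerayRungProfile (L : ℕ) (C : ℝ) (U : ℝ³ → ℝ³) (Q : ℝ³ → ℝ) (E : ℝ³ → ℝ³) : Prop :=
  AngularLadder.IsBandLimited L U ∧ VectorCalculus.IsDivFree U ∧ ContDiff ℝ ∞ Q ∧ ContDiff ℝ ∞ E ∧
    AngularLadder.IsCobandLimited L E ∧ (∀ y, lerayResidual U Q E y = 0) ∧ ∀ y, ‖U y‖ ≤ C / (‖y‖ + 1)

/-- OWED (representation theory of the rotation action; see the module docstring): for a steady rung-`L`
profile band-limited to degree `M` with `2M ≤ L` the Galerkin defect is a gradient, i.e. `U` solves the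
genuine steady Leray system with a smooth pressure. [idea: cstrat-19959 g0, spectral saturation] -/
theorem side_defect_absorbed :
    ∀ (L M : ℕ) (C : ℝ) (U : ℝ³ → ℝ³) (Q : ℝ³ → ℝ) (E : ℝ³ → ℝ³),
      IsSteadyLerayRungProfile L C U Q E → 2 * M ≤ L → AngularLadder.IsBandLimited M U →
      ∃ P' : ℝ³ → ℝ, ContDiff ℝ ∞ P' ∧ ∀ y, lerayResidual U P' 0 y = 0 := by
  sorry

/-- A vector of every prescribed nonnegative norm exists in `ℝ³`. -/
theorem exists_norm_eq (r : ℝ) (hr : 0 ≤ r) : ∃ y : ℝ³, ‖y‖ = r := by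
  refine ⟨r • EuclideanSpace.single 0 (1 : ℝ), ?_⟩
  rw [norm_smul, EuclideanSpace.norm_single, norm_one, mul_one, Real.norm_of_nonneg hr]

/-- PROVED (Tsai 1998 Thm 1, `q = ∞`, tree `IsLerayProfile.exists_eq_const_of_bounded`, plus Type-I decay):
a smooth solution of the genuine steady Leray system `−ΔU + ½U + ½(y·∇)U + (U·∇)U + ∇P' = 0`, `div U = 0`,
with `‖U(y)‖ ≤ C/(‖y‖+1)` is identically zero. [cite: Tsai1998, Thm 1 (p. 31)] -/
theorem eq_zero_of_lerayResidual_zero {C : ℝ} {U : ℝ³ → ℝ³} {P' : ℝ³ → ℝ}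
    (hU : ContDiff ℝ ∞ U) (hP : ContDiff ℝ ∞ P') (hdiv : VectorCalculus.IsDivFree U)
    (hres : ∀ y, lerayResidual U P' 0 y = 0) (hdec : ∀ y, ‖U y‖ ≤ C / (‖y‖ + 1)) :
    ∀ y, U y = 0 := by
  have hprof : IsLerayProfile (1 : ℝ) (1 / 2 : ℝ) U P' :=
    { contDiff_velocity := contDiff_infty.1 hU 2
      contDiff_pressure := contDiff_infty.1 hP 1
      profile_eq := fun y => by simpa [lerayResidual] using hres y
      divFree := hdiv }
  have hbd : ∃ M : ℝ, ∀ y, ‖U y‖ ≤ M := by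
    refine ⟨max C 0, fun y => (hdec y).trans ?_⟩
    rcases le_or_gt 0 C with hC | hC
    · calc C / (‖y‖ + 1) ≤ C / 1 :=
            div_le_div_of_nonneg_left hC one_pos (by linarith [norm_nonneg y])
        _ = C := div_one C
        _ ≤ max C 0 := le_max_left _ _
    · exact (div_neg_of_neg_of_pos hC (by positivity)).le.trans (le_max_right _ _)
  obtain ⟨c, hc⟩ := hprof.exists_eq_const_of_bounded one_pos (by norm_num) hbd
  have hcn : ∀ᶠ n : ℕ in atTop, ‖c‖ ≤ C / (n : ℝ) := by
    refine eventually_atTop.2 ⟨1, fun n hn => ?_⟩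
    have hn' : (1 : ℝ) ≤ n := Nat.one_le_cast.2 hn
    obtain ⟨y, hy⟩ := exists_norm_eq ((n : ℝ) - 1) (by linarith)
    have h := hdec y
    rw [hc y, hy, sub_add_cancel] at h
    exact h
  have hc0 : ‖c‖ ≤ 0 :=
    ge_of_tendsto (tendsto_const_div_atTop_nhds_zero_nat C) hcn
  have hc' : c = 0 := norm_le_zero_iff.1 hc0
  intro y
  rw [hc y, hc']

/-- SPECTRAL SATURATION (composition; closed as soon as `side_defect_absorbed` is): a non-trivial steady
rung-`L` profile carries energy in angular degrees `> L/2`. -/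
theorem spectralSaturation
    (h₁ : ∀ (L M : ℕ) (C : ℝ) (U : ℝ³ → ℝ³) (Q : ℝ³ → ℝ) (E : ℝ³ → ℝ³),
      IsSteadyLerayRungProfile L C U Q E → 2 * M ≤ L → AngularLadder.IsBandLimited M U →
      ∃ P' : ℝ³ → ℝ, ContDiff ℝ ∞ P' ∧ ∀ y, lerayResidual U P' 0 y = 0) :
    ∀ (L M : ℕ) (C : ℝ) (U : ℝ³ → ℝ³) (Q : ℝ³ → ℝ) (E : ℝ³ → ℝ³),
      IsSteadyLerayRungProfile L C U Q E → 2 * M ≤ L → AngularLadder.IsBandLimited M U → ∀ y, U y = 0 := by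
  intro L M C U Q E hprof hML hM
  obtain ⟨P', hP', hres⟩ := h₁ L M C U Q E hprof hML hM
  obtain ⟨hband, hdiv, -, -, -, -, hdec⟩ := hprof
  exact eq_zero_of_lerayResidual_zero hband.1 hP' hdiv hres hdec

/-- Corollary shape used on the card: under spectral saturation, `RungHasLerayProfile L` has NO witness band-limited
to degree `≤ L/2` — non-trivial rung profiles live at the truncation threshold. -/
theorem not_subthreshold_of_rungProfile
    (hsat : ∀ (L M : ℕ) (C : ℝ) (U : ℝ³ → ℝ³) (Q : ℝ³ → ℝ) (E : ℝ³ → ℝ³),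
      IsSteadyLerayRungProfile L C U Q E → 2 * M ≤ L → AngularLadder.IsBandLimited M U → ∀ y, U y = 0)
    {L M : ℕ} {C : ℝ} {U : ℝ³ → ℝ³} {Q : ℝ³ → ℝ} {E : ℝ³ → ℝ³}
    (hprof : IsSteadyLerayRungProfile L C U Q E) (hne : ∃ y, U y ≠ 0) (hML : 2 * M ≤ L) :
    ¬ AngularLadder.IsBandLimited M U := by
  intro hM
  obtain ⟨y, hy⟩ := hne
  exact hy (hsat L M C U Q E hprof hML hM y)

end Summit.NavierStokesRegularity.NavierStokesRegularity.Cruxes.RungBlowupCofinal.Leray.Side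

end
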